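import Summits.Ventures.QEDPrecision.Diagrams.NoLoopVertexGraphs

/-!
Venture QEDPrecision / cell `pub-qed`, unit `pub-qed-diag-2` (DIAG-2, gen 3).  HONEST FRAMING: independent recomputation;
certified where stated, statistical where stated; no new-physics claim.  NEW WORK of the cell (a kernel-checked census), not a
published result: the printed comparators are named only in comments.  Staged copy: HOME/lean/diag2/LeptonLoopGraphs.lean
(HOME = run/shared/lean/pub/pub-qed/); Python mirror of every definition below: the unit folder's tools/loops_model.py, whose
output agrees with the cell's generator HOME/code/diag2/vgraphs.py structure by structure (HOME/pub-qed-diag-2/XCHECK.md §X-F).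

# Kernel-checked counts of QED vertex graphs WITH lepton loops, by loop structure (orders e² … e⁸ here; e¹⁰ in the sequels `LeptonLoopGraphsOrder10*.lean`)

Model (the one of both cell generators).  A vertex graph of order `2n` has `2n + 1` vertices: an open lepton PATH with `p`
vertices (the points `0 … p-1` in path order, `p` odd) and lepton LOOPS of even lengths `lens = [l₀ ≥ l₁ ≥ …]`, loop `j` being
the consecutive block of points `offs[j] … offs[j] + l_j - 1` in cyclic order; one vertex `X` carries the external photon and the
other `2n` points are perfectly matched by the `n` internal photons.  Up to the symmetries of the structure, `X` is a path point or
the FIRST point of a loop.  The graph is ADMISSIBLE iff it is connected and has no bridge (one-particle irreducible, no self-energy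
parts on the external legs); loops have even length by construction (Furry's theorem is built into the model, as in both cell
generators and in AHKN's and Volkov's counts).  Bridgelessness is decided through the CLUSTERS of loops (loops joined by
loop–loop photons): every cluster must be attached to the path by ≥ 2 photons, a loop–loop photon whose removal splits its cluster
must leave both halves attached to the path, and every internal path line `i – i+1` must be spanned by a path–path photon or by a
cluster attached on both sides of it (lines inside a loop are never bridges).

Counting.  DIRECTED graphs (AHKN's objects: oriented path and loops) = orbits of admissible configurations under the structure
group generated by permutations of equal-length loops and rotations of the loops not carrying `X`; UNDIRECTED graphs (Volkov's
objects) = orbits under the larger group with the path reversal and the loop reflections adjoined.  Orbits are counted by the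
orbit-minimum test (`key ≤ key ∘ σ` for every σ, keys compared external vertex first), exactly as in `NoLoopVertexGraphs`.

Certified here (kernel `decide`, no `native_decide`, no axioms): the structure tables of orders 4, 6, 8 — e.g. order 8:
(p, lens) = (9,[]) 518 directed / 269 undirected · (7,[2]) 150/79 · (5,[4]) 102/33 · (5,[2,2]) 18/11 · (3,[6]) 75/24 · (3,[4,2]) 27/9 ·
(3,[2,2,2]) 1/1 · every `p = 1` structure 0/0 — and the totals 7/5, 72/40, 891/426 (directed/undirected).  Printed comparators:
directed totals 7, 72, 891 (Kinoshita–Nio hep-ph/0507249: groups I 25 = 15+6+3+1 inside (3,[6]),(3,[4,2]),(3,[2,2,2]); II 54 = 36+18;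
III 150; IV 144; V 518); undirected no-loop rows 4, 28, 269 (Volkov arXiv:1807.05281); the undirected totals 5, 40, 426 are the cell's
own counts (HOME/pub-qed-diag-2/COUNTS.md §1; Volkov prints no per-class graph numbers at order 8).
-/

namespace Summit.Ventures.QEDPrecision.Diagrams

/-! ## structures and components -/

/-- offsets of the loops: with path length `p`, loop `j` occupies the points `offs[j] … offs[j] + lens[j] - 1`. -/
def loopOffsets : ℕ → List ℕ → List ℕ
  | _, [] => []
  | p, l :: ls => p :: loopOffsets (p + l) ls

/-- helper for `comp`: which loop block contains the point at distance `d` beyond the path. -/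
def compAux : ℕ → List ℕ → ℕ → ℕ
  | _, [], j => j
  | d, l :: ls, j => bif Nat.blt d l then j else compAux (d - l) ls (j + 1)

/-- component of a point: `0` = the open path, `j + 1` = loop `j`. -/
def comp (p : ℕ) (lens : List ℕ) (v : ℕ) : ℕ := bif Nat.blt v p then 0 else compAux (v - p) lens 1

/-- even partitions of `m` into non-increasing parts `≥ 2` and `≤ b` (first argument = fuel). -/
def evenParts : ℕ → ℕ → ℕ → List (List ℕ)
  | _, 0, _ => [[]]
  | 0, _ + 1, _ => []
  | f + 1, m + 1, b =>
      (((List.range (b + 1)).reverse).filter (fun l => l % 2 == 0 && Nat.blt 1 l && Nat.ble l (m + 1))).foldr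
        (fun l acc => ((evenParts f (m + 1 - l) l).map (fun t => l :: t)) ++ acc) []

/-- the loop structures `(p, lens)` of order `2n`: `p` odd from `2n+1` down to `1`, `lens` an even partition of `2n+1-p`. -/
def structures (n : ℕ) : List (ℕ × List ℕ) :=
  ((List.range (n + 1)).reverse).foldr
    (fun i acc => ((evenParts n (2 * n - 2 * i) (2 * n - 2 * i)).map (fun ls => (2 * i + 1, ls))) ++ acc) []

/-! ## admissibility (connected and bridgeless) via loop clusters -/

/-- photon classes of a matching: `PP` (both ends on the path), `PL` (pairs (path point, loop index)), `LL` (pairs of two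
DISTINCT loop indices); photons with both ends on the same loop are dropped (irrelevant for connectivity and bridges). -/
def classify (p : ℕ) (lens : List ℕ) : List (ℕ × ℕ) → List (ℕ × ℕ) × List (ℕ × ℕ) × List (ℕ × ℕ)
  | [] => ([], [], [])
  | e :: M =>
    match classify p lens M with
    | (PP, PL, LL) =>
      let ca := comp p lens e.1
      let cb := comp p lens e.2
      bif ca == 0 && cb == 0 then (e :: PP, PL, LL)
      else bif ca == 0 then (PP, (e.1, cb - 1) :: PL, LL)
      else bif cb == 0 then (PP, (e.2, ca - 1) :: PL, LL)
      else bif ca == cb then (PP, PL, LL)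
      else (PP, PL, (ca - 1, cb - 1) :: LL)

/-- merge the clusters of the two loops joined by a loop–loop photon (cluster table indexed by loop). -/
def mergeClusters (cl : List ℕ) (e : ℕ × ℕ) : List ℕ :=
  let cj := cl.getD e.1 0
  let ck := cl.getD e.2 0
  bif cj == ck then cl else cl.map (fun c => bif c == ck then cj else c)

/-- cluster table of `r` loops joined by the loop–loop photons `LL`. -/
def clusters (r : ℕ) (LL : List (ℕ × ℕ)) : List ℕ := LL.foldl mergeClusters (List.range r)

/-- minimum of a non-empty list (0 on `[]`). -/
def listMin : List ℕ → ℕ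
  | [] => 0
  | a :: l => l.foldl min a

/-- maximum of a list (0 on `[]`). -/
def listMax : List ℕ → ℕ
  | [] => 0
  | a :: l => l.foldl max a

/-- if every cluster in use is attached to the path by at least two photons, the list of the clusters' virtual spans
`(min attachment, max attachment)`; otherwise `none` (a cluster with ≤ 1 attachment is disconnected or hangs on a bridge). -/
def clusterSpans (r : ℕ) (cl : List ℕ) (PL : List (ℕ × ℕ)) : Option (List (ℕ × ℕ)) :=
  (List.range r).foldr (fun c acc =>
    match acc with
    | none => none
    | some spans =>
      bif cl.elem c then
        (let att := (PL.filter (fun e => cl.getD e.2 0 == c)).map Prod.fst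
         bif Nat.ble 2 att.length then some ((listMin att, listMax att) :: spans) else none)
      else some spans) (some [])

/-- no loop–loop photon is a bridge: if removing it splits its cluster, both halves stay attached to the path. -/
def llBridgesOK (r : ℕ) (PL LL : List (ℕ × ℕ)) : Bool :=
  (List.range LL.length).all (fun i =>
    let cl2 := clusters r (LL.eraseIdx i)
    let e := LL.getD i (0, 0)
    let cj := cl2.getD e.1 0
    let ck := cl2.getD e.2 0
    cj == ck || (PL.any (fun f => cl2.getD f.2 0 == cj) && PL.any (fun f => cl2.getD f.2 0 == ck)))

/-- the configuration (structure `(p, lens)`, photons `M`) is connected and bridgeless. -/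
def admissible (p : ℕ) (lens : List ℕ) (M : List (ℕ × ℕ)) : Bool :=
  match classify p lens M with
  | (PP, PL, LL) =>
    let r := lens.length
    match clusterSpans r (clusters r LL) PL with
    | none => false
    | some spans => llBridgesOK r PL LL && irreducible p (PP ++ spans)

/-! ## the structure group, as relabeling tables -/

/-- all permutations of a list of naturals (first argument = fuel ≥ length). -/
def perms : ℕ → List ℕ → List (List ℕ)
  | 0, l => bif l.isEmpty then [[]] else []
  | k + 1, l => l.foldr (fun a acc => ((perms k (l.erase a)).map (fun π => a :: π)) ++ acc) []

/-- cartesian product of a list of choice lists. -/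
def cart : List (List ℕ) → List (List ℕ)
  | [] => [[]]
  | xs :: rest => xs.foldr (fun x acc => ((cart rest).map (fun t => x :: t)) ++ acc) []

/-- the permutations of the loop indices preserving loop lengths. -/
def loopPerms (lens : List ℕ) : List (List ℕ) :=
  (perms lens.length (List.range lens.length)).filter
    (fun π => (List.range lens.length).all (fun j => lens.getD (π.getD j 0) 0 == lens.getD j 0))

/-- rotation choices: every loop may be rotated freely except the loop `el` carrying the external vertex. -/
def rotChoices (lens : List ℕ) (el : Option ℕ) : List (List ℕ) :=
  cart ((List.range lens.length).map (fun j => bif el == some j then [0] else List.range (lens.getD j 0)))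

/-- reflection choices (`1` = reflect) for loops of length `> 2` (for a 2-loop the reflection is a rotation). -/
def flipChoices (lens : List ℕ) : List (List ℕ) :=
  cart (lens.map (fun l => bif Nat.blt 2 l then [0, 1] else [0]))

/-- image of the point `v` under (path reversal `f = 1`, loop permutation `π`, rotations `ρ`, reflections `φ`):
a path point goes to itself or to `p-1-v`; the point at position `t` of loop `j` goes to position `(±t + ρ_j) mod l_j` of loop `π j`. -/
def image (p : ℕ) (lens offs : List ℕ) (f : ℕ) (π ρ φ : List ℕ) (v : ℕ) : ℕ :=
  bif Nat.blt v p then (bif f == 1 then p - 1 - v else v)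
  else
    let j := comp p lens v - 1
    let l := lens.getD j 0
    let t := v - offs.getD j 0
    let t1 := bif φ.getD j 0 == 1 then (l - t) % l else t
    offs.getD (π.getD j 0) 0 + (t1 + ρ.getD j 0) % l

/-- the relabeling tables (`table[v]` = image of `v`, `v < V`) for all choices `f ∈ fs`, `π ∈ P`, `ρ ∈ R`, `φ ∈ F`. -/
def symTables (p : ℕ) (lens offs : List ℕ) (V : ℕ) (fs : List ℕ) (P R F : List (List ℕ)) : List (List ℕ) :=
  fs.foldr (fun f acc =>
    (P.foldr (fun π acc2 =>
      (R.foldr (fun ρ acc3 =>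
        (F.foldr (fun φ acc4 => ((List.range V).map (image p lens offs f π ρ φ)) :: acc4) []) ++ acc3) []) ++ acc2) [])
    ++ acc) []

/-! ## orbit-minimum test -/

/-- image of a photon under a relabeling table, ends sorted. -/
def imgPair (tab : List ℕ) (e : ℕ × ℕ) : ℕ × ℕ :=
  let a := tab.getD e.1 0
  let b := tab.getD e.2 0
  bif Nat.blt a b then (a, b) else (b, a)

/-- insert a photon into a list sorted by first end. -/
def insertPair (e : ℕ × ℕ) : List (ℕ × ℕ) → List (ℕ × ℕ)
  | [] => [e]
  | x :: l => bif Nat.blt e.1 x.1 then e :: x :: l else x :: insertPair e l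

/-- insertion sort of photons by first end. -/
def sortPairs : List (ℕ × ℕ) → List (ℕ × ℕ)
  | [] => []
  | e :: l => insertPair e (sortPairs l)

/-- flatten a list of photons. -/
def flat : List (ℕ × ℕ) → List ℕ
  | [] => []
  | e :: l => e.1 :: e.2 :: flat l

/-- the configuration (external vertex `ext`, photons `M` as produced by `pm`: sorted, ends increasing) is the minimum of its
orbit under the tables `G`: for every table, the key (image of `ext`, then the sorted image photons) is not smaller. -/
def isOrbitMin (ext : ℕ) (G : List (List ℕ)) (M : List (ℕ × ℕ)) : Bool :=
  let k0 := flat M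
  G.all (fun tab =>
    let x := tab.getD ext 0
    Nat.blt ext x || (x == ext && lexLE k0 (flat (sortPairs (M.map (imgPair tab))))))

/-! ## the census -/

/-- `(directed, undirected)` numbers of admissible vertex graphs of order `2n` with loop structure `(p, lens)`:
sum over the placements of the external vertex (path points, first point of each loop) of the numbers of orbit minima
under the direction-preserving tables (identity dropped) and, among those, under the additional reversing/reflecting tables. -/
def countRow (n p : ℕ) (lens : List ℕ) : ℕ × ℕ :=
  let V := p + lens.sum
  let offs := loopOffsets p lens
  let P := loopPerms lens
  let Fall := flipChoices lens
  let placements : List (ℕ × Option ℕ) :=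
    (List.range p).map (fun i => (i, none)) ++ (List.range lens.length).map (fun j => (offs.getD j 0, some j))
  placements.foldl (fun acc pl =>
    let R := rotChoices lens pl.2
    let Gd := (symTables p lens offs V [0] P R (Fall.take 1)).drop 1
    let Gx := symTables p lens offs V [1] P R Fall ++ symTables p lens offs V [0] P R (Fall.drop 1)
    let canD := ((pm n ((List.range V).erase pl.1)).filter (admissible p lens)).filter (isOrbitMin pl.1 Gd)
    (acc.1 + canD.length, acc.2 + (canD.filter (isOrbitMin pl.1 Gx)).length)) (0, 0)

/-- the structure table of order `2n`: one row `(p, lens, directed, undirected)` per loop structure. -/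
def structureTable (n : ℕ) : List (ℕ × List ℕ × ℕ × ℕ) :=
  (structures n).map (fun s => (s.1, s.2, countRow n s.1 s.2))

/-- column sums `(directed, undirected)` of a structure table. -/
def tableTotals (T : List (ℕ × List ℕ × ℕ × ℕ)) : ℕ × ℕ :=
  T.foldl (fun acc row => (acc.1 + row.2.2.1, acc.2 + row.2.2.2)) (0, 0)

/-! ## sanity of the enumerators -/

/-- the loop structures of orders 4 … 10 (p odd, even parts), e.g. 19 structures at order 10. -/
theorem structures_values :
    structures 2 = [(5, []), (3, [2]), (1, [4]), (1, [2, 2])] ∧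
    structures 3 = [(7, []), (5, [2]), (3, [4]), (3, [2, 2]), (1, [6]), (1, [4, 2]), (1, [2, 2, 2])] ∧
    structures 4 = [(9, []), (7, [2]), (5, [4]), (5, [2, 2]), (3, [6]), (3, [4, 2]), (3, [2, 2, 2]),
                    (1, [8]), (1, [6, 2]), (1, [4, 4]), (1, [4, 2, 2]), (1, [2, 2, 2, 2])] ∧
    structures 5 = [(11, []), (9, [2]), (7, [4]), (7, [2, 2]), (5, [6]), (5, [4, 2]), (5, [2, 2, 2]),
                    (3, [8]), (3, [6, 2]), (3, [4, 4]), (3, [4, 2, 2]), (3, [2, 2, 2, 2]),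
                    (1, [10]), (1, [8, 2]), (1, [6, 4]), (1, [6, 2, 2]), (1, [4, 4, 2]), (1, [4, 2, 2, 2]),
                    (1, [2, 2, 2, 2, 2])] := by
  decide +kernel

/-- group orders: `|G_dir|`+`|G_und extra|` tables generated for structure (3,[2,2,2,2]) with `X` on the path: 384 − 1 and 384;
for (3,[4,4]) with `X` on the path: 31 and 224; with `X` on loop 0: 7 and 56. -/
theorem symTables_card :
    ((symTables 3 [2,2,2,2] (loopOffsets 3 [2,2,2,2]) 11 [0] (loopPerms [2,2,2,2]) (rotChoices [2,2,2,2] none)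
        ((flipChoices [2,2,2,2]).take 1)).drop 1).length = 383 ∧
    (symTables 3 [2,2,2,2] (loopOffsets 3 [2,2,2,2]) 11 [1] (loopPerms [2,2,2,2]) (rotChoices [2,2,2,2] none)
        (flipChoices [2,2,2,2]) ++
     symTables 3 [2,2,2,2] (loopOffsets 3 [2,2,2,2]) 11 [0] (loopPerms [2,2,2,2]) (rotChoices [2,2,2,2] none)
        ((flipChoices [2,2,2,2]).drop 1)).length = 384 ∧
    ((symTables 3 [4,4] (loopOffsets 3 [4,4]) 11 [0] (loopPerms [4,4]) (rotChoices [4,4] none)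
        ((flipChoices [4,4]).take 1)).drop 1).length = 31 ∧
    (symTables 3 [4,4] (loopOffsets 3 [4,4]) 11 [1] (loopPerms [4,4]) (rotChoices [4,4] none) (flipChoices [4,4]) ++
     symTables 3 [4,4] (loopOffsets 3 [4,4]) 11 [0] (loopPerms [4,4]) (rotChoices [4,4] none)
        ((flipChoices [4,4]).drop 1)).length = 224 ∧
    ((symTables 3 [4,4] (loopOffsets 3 [4,4]) 11 [0] (loopPerms [4,4]) (rotChoices [4,4] (some 0))
        ((flipChoices [4,4]).take 1)).drop 1).length = 7 ∧
    (symTables 3 [4,4] (loopOffsets 3 [4,4]) 11 [1] (loopPerms [4,4]) (rotChoices [4,4] (some 0)) (flipChoices [4,4]) ++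
     symTables 3 [4,4] (loopOffsets 3 [4,4]) 11 [0] (loopPerms [4,4]) (rotChoices [4,4] (some 0))
        ((flipChoices [4,4]).drop 1)).length = 56 := by
  decide +kernel

/-- consistency with `NoLoopVertexGraphs`: for the loop-free structure the census is the (directed, undirected) pair of that file,
n ≤ 4, on the numerals. -/
theorem countRow_noLoops :
    countRow 1 3 [] = (vertexDirected 1, vertexUndirected 1) ∧ countRow 2 5 [] = (vertexDirected 2, vertexUndirected 2) ∧
    countRow 3 7 [] = (vertexDirected 3, vertexUndirected 3) ∧ countRow 4 9 [] = (vertexDirected 4, vertexUndirected 4) := by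
  obtain ⟨a1, a2, a3, a4⟩ := vertexDirected_values
  obtain ⟨b1, b2, b3, b4⟩ := vertexUndirected_values
  rw [a1, a2, a3, a4, b1, b2, b3, b4]
  decide +kernel

/-! ## orders 2, 4, 6 -/

/-- order e²: the single vertex graph; order e⁴: 6 directed / 4 undirected loop-free graphs and the one vacuum-polarisation
insertion (3,[2]); totals 7 / 5. -/
theorem order2_order4_table :
    structureTable 1 = [(3, [], 1, 1), (1, [2], 0, 0)] ∧
    structureTable 2 = [(5, [], 6, 4), (3, [2], 1, 1), (1, [4], 0, 0), (1, [2, 2], 0, 0)] ∧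
    tableTotals (structureTable 2) = (7, 5) := by
  decide +kernel

/-- order e⁶: (7,[]) 50/28 · (5,[2]) 12/7 · (3,[4]) 9/4 (light-by-light 6/2 + second-order vertex with a 4th-order
vacuum polarisation 3/2) · (3,[2,2]) 1/1; totals 72 / 40. -/
theorem order6_table :
    structureTable 3 = [(7, [], 50, 28), (5, [2], 12, 7), (3, [4], 9, 4), (3, [2, 2], 1, 1),
                        (1, [6], 0, 0), (1, [4, 2], 0, 0), (1, [2, 2, 2], 0, 0)] ∧
    tableTotals (structureTable 3) = (72, 40) := by
  decide +kernel

/-! ## order 8 -/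

set_option maxRecDepth 20000 in
/-- order e⁸ structure table: (9,[]) 518/269 · (7,[2]) 150/79 · (5,[4]) 102/33 · (5,[2,2]) 18/11 · (3,[6]) 75/24 · (3,[4,2]) 27/9 ·
(3,[2,2,2]) 1/1 · all `p = 1` structures empty.  (Kinoshita–Nio groups: V = 518; III = 150; II[P4] 36 + IV(c) 48 + IV(d) 18 = 102;
II[P2,P2] = 18; I(d) 15 + IV(b) 60 = 75; I(b) 6 + I(c) 3 + IV(a) 18 = 27; I(a) = 1.) -/
theorem order8_table :
    structureTable 4 = [(9, [], 518, 269), (7, [2], 150, 79), (5, [4], 102, 33), (5, [2, 2], 18, 11), (3, [6], 75, 24),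
                        (3, [4, 2], 27, 9), (3, [2, 2, 2], 1, 1), (1, [8], 0, 0), (1, [6, 2], 0, 0), (1, [4, 4], 0, 0),
                        (1, [4, 2, 2], 0, 0), (1, [2, 2, 2, 2], 0, 0)] := by
  decide +kernel

/-- order e⁸ totals: 891 directed (AHKN) / 426 undirected (Volkov's objects), from the table. -/
theorem order8_totals : tableTotals (structureTable 4) = (891, 426) := by
  rw [order8_table]
  decide

end Summit.Ventures.QEDPrecision.Diagrams
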